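import Mathlib.RingTheory.RootsOfUnity.Complex
import Mathlib.Algebra.Field.GeomSum
import Literature.Computability.AlgebraicComplexity.SchoenhageTau

/-!
# `OrbitHarmonicsHosts.TruncatedPolynomialVacuity` — helper: the truncated polynomial
# multiplication tensor `T_M` has border rank `≤ M`

Route `MatrixMultiplication/OrbitHarmonicsHosts`, support item `stmt-MatrixMultiplication-5457`.
`T_M ∈ ℂ^{M×M×M}`, `T_M(k,i,j) = [i + j = k]` (output index first), is the structure tensor of
`ℂ[x]/(x^M)` in the monomial basis.  Bini-type approximate decomposition of order `M - 1` with
`M` triads (evaluation at `ε·ζ^s`, `ζ` a primitive `M`-th root of unity, followed by the inverse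
DFT): with `u_s(k) = ζ^{s(M-k)}/M · ε^{M-1-k}`, `v_s(i) = ζ^{si} ε^i`, `w_s(j) = ζ^{sj} ε^j`,
`∑_s u_s(k) v_s(i) w_s(j) = [M ∣ M-k+i+j] · ε^{M-1-k+i+j}`, whose part of degree `≤ M-1` is
exactly `[i+j=k] ε^{M-1}` (the wrap-around terms `i + j = k + M` sit in degree `2M-1`).
Hence `bR(T_M) ≤ R_{M-1}(T_M) ≤ M` (Bläser 2013, Def. 6.1; the classical fact that
`ℂ[x]/(x^M)` has minimal border rank).
-/

-- the tree's namespace `Summit.MatrixMultiplication.MatrixMultiplication.…` repeats a component by design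
set_option linter.dupNamespace false

noncomputable section

namespace Summit.MatrixMultiplication.MatrixMultiplication.Theorems

open scoped BigOperators Polynomial
open Literature.Computability.AlgebraicComplexity hiding MatrixMultiplication

/-- Orthogonality of the characters of `ℤ/M`: for a primitive `M`-th root of unity `ζ`,
`∑_{s<M} (ζ^m)^s = M` if `M ∣ m` and `0` otherwise. [folklore] -/
theorem truncPoly_sum_root_pow {M : ℕ} {ζ : ℂ} (hζ : IsPrimitiveRoot ζ M) (m : ℕ) :
    ∑ s : Fin M, (ζ ^ m) ^ (s : ℕ) = if M ∣ m then (M : ℂ) else 0 := by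
  rw [Fin.sum_univ_eq_sum_range (fun s => (ζ ^ m) ^ s) M]
  split_ifs with h
  · have h1 : ζ ^ m = 1 := (hζ.pow_eq_one_iff_dvd m).2 h
    simp [h1]
  · have h1 : ζ ^ m ≠ 1 := fun e => h ((hζ.pow_eq_one_iff_dvd m).1 e)
    rw [geom_sum_eq h1, ← pow_mul, mul_comm, pow_mul, hζ.pow_eq_one, one_pow, sub_self, zero_div]

/-- The DFT approximate decomposition of order `M - 1` of `T_M` with `M` triads over `ℂ[ε]`
(`ζ` a primitive `M`-th root of unity, `M ≥ 1`). [folklore] -/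
theorem truncPoly_isApproxDecomposition {M : ℕ} {ζ : ℂ} (hζ : IsPrimitiveRoot ζ M) (hM : 0 < M) :
    IsApproxDecomposition (M - 1) (fun k i j : Fin M => if (i : ℕ) + j = k then (1 : ℂ) else 0)
      (fun (s : Fin M) (k : Fin M) =>
        Polynomial.C (ζ ^ ((s : ℕ) * (M - k)) / M) * Polynomial.X ^ (M - 1 - k))
      (fun (s : Fin M) (i : Fin M) => Polynomial.C (ζ ^ ((s : ℕ) * i)) * Polynomial.X ^ (i : ℕ))
      (fun (s : Fin M) (j : Fin M) => Polynomial.C (ζ ^ ((s : ℕ) * j)) * Polynomial.X ^ (j : ℕ)) := by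
  intro k i j d hd
  have hk := k.2
  have hi := i.2
  have hj := j.2
  have hM0 : (M : ℂ) ≠ 0 := by exact_mod_cast hM.ne'
  -- each summand is `((ζ^{M-k+i+j})^s / M) · ε^{M-1-k+i+j}`
  have hterm : ∀ s : Fin M,
      Polynomial.C (ζ ^ ((s : ℕ) * (M - k)) / M) * Polynomial.X ^ (M - 1 - k) *
        (Polynomial.C (ζ ^ ((s : ℕ) * i)) * Polynomial.X ^ (i : ℕ)) *
        (Polynomial.C (ζ ^ ((s : ℕ) * j)) * Polynomial.X ^ (j : ℕ)) =
      Polynomial.C ((ζ ^ (M - k + i + j)) ^ (s : ℕ) / M) *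
        Polynomial.X ^ (M - 1 - k + i + j) := by
    intro s
    have hcoef : ζ ^ ((s : ℕ) * (M - k)) / M * ζ ^ ((s : ℕ) * i) * ζ ^ ((s : ℕ) * j) =
        (ζ ^ (M - k + i + j)) ^ (s : ℕ) / M := by
      rw [← pow_mul, show (M - k + i + j) * (s : ℕ) = (s : ℕ) * (M - k) + (s : ℕ) * i + (s : ℕ) * j
        by ring, pow_add, pow_add]
      ring
    calc _ = Polynomial.C (ζ ^ ((s : ℕ) * (M - k)) / M) * Polynomial.C (ζ ^ ((s : ℕ) * i)) *
          Polynomial.C (ζ ^ ((s : ℕ) * j)) *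
          (Polynomial.X ^ (M - 1 - k) * Polynomial.X ^ (i : ℕ) * Polynomial.X ^ (j : ℕ)) := by ring
      _ = _ := by rw [← map_mul, ← map_mul, ← pow_add, ← pow_add, hcoef]
  rw [Finset.sum_congr rfl fun s _ => hterm s, ← Finset.sum_mul, ← map_sum, ← Finset.sum_div,
    truncPoly_sum_root_pow hζ, Polynomial.coeff_C_mul_X_pow]
  dsimp only
  -- case analysis on the degrees
  by_cases hsum : (i : ℕ) + j = k
  · -- the genuine product `x^i · x^j = x^k`: exponent `M`, degree `M - 1`
    have hm : M - k + i + j = M := by omega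
    have he : M - 1 - k + i + j = M - 1 := by omega
    rw [hm, he, if_pos hsum, if_pos (dvd_refl M), div_self hM0]
  · rw [if_neg hsum, ite_self]
    split_ifs with h1 h2
    · exfalso
      -- `d = M-1-k+i+j ≤ M-1` forces `i + j ≤ k`, so `0 < M-k+i+j ≤ M` and `M ∣ _` gives equality
      have hle : M - k + i + j ≤ M := by omega
      have hpos : 0 < M - k + i + j := by omega
      have hge : M ≤ M - k + i + j := Nat.le_of_dvd hpos h2
      omega
    · simp
    · rfl

/-- **`bR(T_M) ≤ M`**: the truncated polynomial multiplication tensor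
`T_M(k,i,j) = [i+j=k]` on `Fin M` (structure tensor of `ℂ[x]/(x^M)`) has border rank at most
`M` (Bläser 2013, Def. 6.1; DFT approximate decomposition of order `M-1`). [folklore] -/
theorem algBorderRank_truncPoly_le (M : ℕ) :
    algBorderRank (fun k i j : Fin M => if (i : ℕ) + j = k then (1 : ℂ) else 0) ≤ M := by
  rcases Nat.eq_zero_or_pos M with rfl | hM
  · refine (algBorderRank_le_approxRank 0 _).trans ?_
    refine approxRank_le_of_isApproxDecomposition (u := fun s => Fin.elim0 s)
      (v := fun s => Fin.elim0 s) (w := fun s => Fin.elim0 s) ?_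
    intro a
    exact Fin.elim0 a
  · have hζ := Complex.isPrimitiveRoot_exp M hM.ne'
    exact (algBorderRank_le_approxRank (M - 1) _).trans
      (approxRank_le_of_isApproxDecomposition (truncPoly_isApproxDecomposition hζ hM))

end Summit.MatrixMultiplication.MatrixMultiplication.Theorems

end
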